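import Literature.Geometry.Lorentzian.HypersurfaceHessian
import Literature.Geometry.Lorentzian.SchoenYauStableSurface
import Literature.Geometry.Riemannian.MonotonicityFormula
import Literature.Geometry.Riemannian.RicciFlowScalarCurvatureProofs
import HarnessLib

/-!
# The monotonicity formula for minimal hypersurfaces with respect to a convex function

Let `f : (N^k, f^*g) → (M^{k+1}, g)` be a spacelike immersion of a hypersurface into a Riemannian
manifold, with smooth unit normal `ν` and mean curvature `H ≡ 0`, and let `φ ∈ C^∞(M)`, `φ ≥ 0`,
satisfy `Hess_g φ ≥ c g` and `|∇φ|²_g ≤ c₂ φ` on `{φ < S}` (`c₂ > 0`), the pieces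
`{φ ∘ f ≤ t}` (`t < S`) of the hypersurface being compact. We PROVE

* `mul_le_dalembertian_comp_of_hessian_ge` — `Δ_{f^*g}(φ ∘ f) ≥ k c` (the trace of
  `Hess φ|_{TΣ}`, `HypersurfaceHessian.dalembertian_comp_eq` with `H = 0`, in an `f^*g`-orthonormal
  basis);
* `measureReal_setOf_comp_lt_div_rpow_mono` — **monotonicity**:
  `s ↦ Area_{f^*g}{φ ∘ f < s} / s^{k c/c₂}` is nondecreasing on `(0, S)`, by the intrinsic
  monotonicity formula `Riemannian.measureReal_setOf_lt_div_rpow_mono`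
  (`MonotonicityFormula.lean`) for `u = φ ∘ f`, whose second hypothesis `|∇u|² ≤ c₂ u` is
  `gradSq_comp_le_of_isSpacelikeImmersion`.

For `M = ℝ^{k+1}` and `φ = |x − x₀|²/2` (`Hess φ = g`, `|∇φ|² = 2φ`; `s = r²/2`) this is the
classical monotonicity of `Vol(Σ ∩ B_r(x₀))/r^k` for a minimal hypersurface without boundary in
the ball (Morgan 2016, Thm. 9.3 — stated there for area-minimising currents — with the Remark
"Monotonicity … holds for stationary (minimal) surfaces [Allard, 5.1]" and Cor. 9.5,
`Area ≥ πr²`; Simon 1983, §17). The convex-function form is the one available on a Riemannian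
manifold: e.g. far out on an asymptotically flat end `|y|²` is uniformly convex
(Schoen–Yau 1979, §2, (2.4); the tree's `EndNormSqConvex.lean`), which gives almost-monotonicity
with exponent `k(1−ε)/(2(1+ε))`; in the first proof of Schoen–Yau's Claim the Euclidean case enters
as the area bound (2.23), `A(Σᵢ ∩ B_r(x₀)) ≥ πr²` (p. 56).

Everything is proved; no definitions, no named facts.

## References

* F. Morgan, *Geometric Measure Theory. A Beginner's Guide*, 5th ed., Academic Press 2016, §9.2,
  Thm. 9.3, Remark, Cor. 9.5. [Morgan2016]
* W. K. Allard, *On the first variation of a varifold*, Ann. of Math. 95 (1972), §5.1. [Allard1972]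
* L. Simon, *Lectures on Geometric Measure Theory*, ANU 1983, §17. [Simon1983]
* R. Schoen, S.-T. Yau, Comm. Math. Phys. 65 (1979) 45–76, §2, (2.4) and p. 56 (2.23).
  [SchoenYauPMT1979]
-/

noncomputable section

open Bundle Set Function Filter Module MeasureTheory
open scoped Manifold ContDiff Topology

namespace Literature.Geometry.Lorentzian

namespace PseudoRiemannianMetric

open Literature.Geometry.Riemannian

variable {E : Type*} [NormedAddCommGroup E] [NormedSpace ℝ E] {H : Type*} [TopologicalSpace H]
  {I : ModelWithCorners ℝ E H} {M : Type*} [TopologicalSpace M] [ChartedSpace H M]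
  [IsManifold I ∞ M] [FiniteDimensional ℝ E] [CompleteSpace E] [I.Boundaryless]
  (g : PseudoRiemannianMetric I ∞ E (TangentSpace I : M → Type _)) [g.HasLeviCivita]
  {k : ℕ} {H' : Type*} [TopologicalSpace H']
  {I' : ModelWithCorners ℝ (EuclideanSpace ℝ (Fin k)) H'} [I'.Boundaryless]
  {N : Type*} [TopologicalSpace N] [ChartedSpace H' N] [IsManifold I' ∞ N]
  {f : N → M} (hpb : contMDiff_pullbackBilin I M I' N ∞) (hfi : g.IsSpacelikeImmersion I' f)
  {ν : NormalField I f}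

/-- **`Δ_Σ (φ|_Σ) ≥ k c` on a minimal hypersurface when `Hess φ ≥ c g`.** For a spacelike immersion
`f : (N^k, f^*g) → (M^{k+1}, g)` with smooth unit normal `ν` (`g(ν,ν) = 1`) and mean curvature
`H ≡ 0`, a function `φ ∈ C²(M)` and a point `y` where `Hess_g φ(w, w) ≥ c g(w, w)` for all
`w ∈ T_{f y}M`: `Δ_{f^*g}(φ ∘ f)(y) = tr_{f^*g} Hess φ|_{df(T_yN)} ≥ k c`
(`dalembertian_comp_eq` with `H = 0`, and the trace in an `f^*g`-orthonormal basis). For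
`M = ℝ^{k+1}`, `φ = |x|²/2`: `Hess φ = g`, `Δ_Σ φ = k` — "the coordinate functions of a minimal
submanifold are harmonic" (Morgan 2016, §9.2 Remark; Simon 1983, §17).
[cite: Morgan2016, Thm. 9.3 and Remark] -/
theorem mul_le_dalembertian_comp_of_hessian_ge
    (hν : ContMDiff I' I.tangent ∞ (fun x ↦ (TotalSpace.mk' E (f x) (ν x) : TangentBundle I M)))
    (hun : g.IsUnitNormal I' f ν 1) (hdim : finrank ℝ E = k + 1)
    (hmin : ∀ y, g.meanCurvature f hpb hfi ν y = 0)
    {φ : M → ℝ} (hφ : CMDiff 2 φ) {c : ℝ} {y : N}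
    (hHess : ∀ w : TangentSpace I (f y), c * g.val (f y) w w ≤ g.hessian φ (f y) w w) :
    haveI := (g.inducedMetric f hpb hfi).hasLeviCivita
    (k : ℝ) * c ≤ (g.inducedMetric f hpb hfi).dalembertian (fun y ↦ φ (f y)) y := by
  haveI := (g.inducedMetric f hpb hfi).hasLeviCivita
  set γ := g.inducedMetric f hpb hfi with hγ
  have hdim' : finrank ℝ E = finrank ℝ (EuclideanSpace ℝ (Fin k)) + 1 := by
    rw [finrank_euclideanSpace_fin]; exact hdim
  rw [g.dalembertian_comp_eq hpb hfi hν hun one_ne_zero hdim' hφ y, hmin y, mul_zero, sub_zero]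
  -- an `f^*g`-orthonormal basis of `T_y N`
  have hγpos : ∀ v : TangentSpace I' y, v ≠ 0 → 0 < γ.val y v v :=
    fun v hv ↦ (g.isRiemannian_inducedMetric f hpb hfi) y v hv
  obtain ⟨b, hb⟩ := γ.exists_basis_isOrthonormalFrame (x := y) hγpos
    (finrank_euclideanSpace_fin (𝕜 := ℝ) (n := k))
  rw [γ.trace_eq_sum_of_isOrthonormalFrame b hb]
  have hterm : ∀ i, c ≤ ((g.hessian φ (f y)).comp (mfderiv I' I f y).toLinearMap
      (mfderiv I' I f y).toLinearMap) (b i) (b i) := by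
    intro i
    have h1 := hHess (mfderiv I' I f y (b i))
    have h2 : g.val (f y) (mfderiv I' I f y (b i)) (mfderiv I' I f y (b i)) = 1 := by
      have := hb.1 i
      rw [hγ, inducedMetric_val, inducedBilin_apply] at this
      exact this
    rw [h2, mul_one] at h1
    simpa [LinearMap.BilinForm.comp_apply] using h1
  calc (k : ℝ) * c = ∑ _i : Fin k, c := by simp
    _ ≤ ∑ i, ((g.hessian φ (f y)).comp (mfderiv I' I f y).toLinearMap
        (mfderiv I' I f y).toLinearMap) (b i) (b i) := Finset.sum_le_sum fun i _ ↦ hterm i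

variable [T2Space N] [LocallyCompactSpace N] [SigmaCompactSpace N] [MeasurableSpace N]
  [BorelSpace N]

/-- **The monotonicity formula for minimal hypersurfaces with respect to a convex function.**
Let `f : (N^k, f^*g) → (M^{k+1}, g)` be a spacelike immersion into a Riemannian manifold with
smooth unit normal and `H ≡ 0` (minimal), and `φ ∈ C^∞(M)`, `φ ≥ 0`, with

  `Hess_g φ ≥ c g`  and  `|∇φ|²_g ≤ c₂ φ`  on `{φ < S}`   (`c₂ > 0`),

such that the pieces `{φ ∘ f ≤ t}`, `t < S`, of the hypersurface are compact ("no boundary in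
`{φ < S}`"). Then

  `s ↦ Area_{f^*g} {φ ∘ f < s} / s^{k c / c₂}`   is nondecreasing on `(0, S)`.

Proof: `u = φ ∘ f` has `Δu ≥ k c` (`mul_le_dalembertian_comp_of_hessian_ge`) and
`|∇u|² ≤ |∇φ|² ∘ f ≤ c₂ u` (`gradSq_comp_le_of_isSpacelikeImmersion`), so the intrinsic
monotonicity formula `measureReal_setOf_lt_div_rpow_mono` (`MonotonicityFormula.lean`) applies.
For `M = ℝ^{k+1}`, `φ = |x − x₀|²/2` (`c = 1`, `c₂ = 2`, `s = r²/2`) this is the monotonicity of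
`Vol(Σ ∩ B_r(x₀))/r^k` for minimal hypersurfaces without boundary in the ball (Morgan 2016,
Thm. 9.3 with the Remark — Allard 1972, 5.1 — and Cor. 9.5; Simon 1983, §17); with `c = 1 − ε`,
`c₂ = 2(1 + ε)` it is the almost-monotonicity far out on an asymptotically flat end, where `|y|²`
is uniformly convex (Schoen–Yau 1979, (2.4)), as used for the area bound (2.23) of the first proof
of their Claim. [cite: Morgan2016, Thm. 9.3, Remark and Cor. 9.5] [cite: SchoenYauPMT1979, §2, (2.4) and (2.23)] -/
theorem measureReal_setOf_comp_lt_div_rpow_mono (hg : g.IsRiemannian)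
    (hν : ContMDiff I' I.tangent ∞ (fun x ↦ (TotalSpace.mk' E (f x) (ν x) : TangentBundle I M)))
    (hun : g.IsUnitNormal I' f ν 1) (hdim : finrank ℝ E = k + 1)
    (hmin : ∀ y, g.meanCurvature f hpb hfi ν y = 0)
    {φ : M → ℝ} (hφ : CMDiff ∞ φ) (hφ0 : ∀ x, 0 ≤ φ x) {S c c₂ : ℝ} (hc₂ : 0 < c₂)
    (hHess : ∀ x, φ x < S → ∀ w : TangentSpace I x, c * g.val x w w ≤ g.hessian φ x w w)
    (hgrad : ∀ x, φ x < S → g.gradSq φ x ≤ c₂ * φ x)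
    (hcpt : ∀ t < S, IsCompact {y | φ (f y) ≤ t})
    {s₁ s₂ : ℝ} (hs₁ : 0 < s₁) (h₁₂ : s₁ ≤ s₂) (hs₂ : s₂ < S) :
    (riemannianMeasure (g.inducedRiemannianMetric f hpb hfi)).real {y | φ (f y) < s₁} /
        s₁ ^ (k * c / c₂) ≤
      (riemannianMeasure (g.inducedRiemannianMetric f hpb hfi)).real {y | φ (f y) < s₂} /
        s₂ ^ (k * c / c₂) := by
  haveI : (ofRiemannian (g.inducedRiemannianMetric f hpb hfi)).HasLeviCivita :=
    (g.inducedMetric f hpb hfi).hasLeviCivita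
  have hu : ContMDiff I' 𝓘(ℝ, ℝ) ∞ (fun y ↦ φ (f y)) := hφ.comp hfi.contMDiff_self
  have hφ2 : CMDiff 2 φ := hφ.of_le (by norm_cast)
  refine measureReal_setOf_lt_div_rpow_mono (g.inducedRiemannianMetric f hpb hfi) hu
    (fun y ↦ hφ0 (f y)) hcpt hc₂ (fun y hy ↦ ?_) (fun y hy ↦ ?_) hs₁ h₁₂ hs₂
  · exact g.mul_le_dalembertian_comp_of_hessian_ge hpb hfi hν hun hdim hmin hφ2 (hHess (f y) hy)
  · have h1 : (g.inducedMetric f hpb hfi).gradSq (φ ∘ f) y ≤ g.gradSq φ (f y) :=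
      g.gradSq_comp_le_of_isSpacelikeImmersion hg hpb hfi ((hφ (f y)).mdifferentiableAt (by simp))
        ((hfi.contMDiff_self y).mdifferentiableAt (by simp))
    exact h1.trans (hgrad (f y) hy)

end PseudoRiemannianMetric

end Literature.Geometry.Lorentzian

end
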